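import Summits.ResolutionOfSingularities.ResolutionOfSingularities.Theorems.EquisingularLiftEquisingularLiftNatF102CoordinatesOfIso
import Literature.AlgebraicGeometry.Morphisms.IsoLocusClosedFibre
import Literature.AlgebraicGeometry.Modules.IsoOfSectionsOnBasis
import HarnessLib

/-!
# [OURS · L1 W4.5(b) · LINE (T-j)-PROOF · BRICK B4, sub-brick (B4-e)] A morphism `u : 𝓘_{D₀} → 𝓘_{D₁}` of the section ideals which is
# onto modulo `ϖ` near the closed fibre is an isomorphism

Crux chain w45b (cell `res-hironaka`), EL♮(3) stmt-ResolutionOfSingularities-20148, LINE (T-j)-PROOF of F-102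
`Literature.AlgebraicGeometry.Resolution.GenusZeroOverCompleteDVR` (res-L1-w45b-lead-2 g3, skeleton v3 1683bb741349c142), BRICK B4
`F102.exists_coordinate_functions`, step (e) (res-L1-type-o6 g30, SPLIT v2 2026-08-27T22:11Z). OURS; NOT a statement of any manuscript;
AI-written, weaker than expert review. No `sorry`; standard axioms; DEF-FREE. `--supports stmt-ResolutionOfSingularities-20148 --as helper`.

SETTING. `f : C → Spec O` universally closed (e.g. proper) over a local ring `O`, `C` integral; `s : T → C`, `s' : T' → C` regular immersions
of codimension one (in B4: the two sections, (B4-a3) `isRegularImmersionOfCodim_one_of_section`, p578264); `𝓘_s = Deformation.idealModule s`;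
`u : 𝓘_s → 𝓘_{s'}` a morphism of `𝒪_C`-modules; `ϖ ∈ 𝔪_O`.

* `exists_affine_principal` — near every point of `C` the ideal of a codimension-one regular immersion is principal on an affine open,
  generated by a NONZERO function (off the image: by `1`); `principal_of_le` — and stays so on smaller affine opens (ideal sheaves are
  quasi-coherent: Mathlib `IdealSheafData.map_ideal`); `exists_section_of_eq_span`, `exists_eq_smul_of_eq_span` — the corresponding generator
  `m ∈ Γ(V, 𝓘_s)` (`ι(m) = r`) and `Γ(V, 𝓘_s) = Γ(V, 𝒪_C) · m`.
* `not_mem_basicOpen_varpi` — a point over the closed point is not in `C_{ϖ}`.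
* `mem_basicOpen_of_surjective_mod` — THE NAKAYAMA STEP: on an affine `V ∋ x` over the closed point carrying generators `m`, `m'` of
  `𝓘_s`, `𝓘_{s'}`, write `ι(u(m)) = q · ι(m')`; if `Γ(V, 𝓘_{s'}) = u(Γ(V, 𝓘_s)) + ϖ Γ(V, 𝓘_{s'})` then `1 = αq + ϖγ`, so `q` is a unit at
  `x`: `x ∈ C_q`.
* `bijective_app_of_isUnit` — on an affine `V` with generators and `ι(u(m)) = q ι(m')`, `q` a unit: `u_V` is bijective.
* **`isIso_of_surjective_mod`** — (B4-e): if every point `x` over the closed point has a neighbourhood `V_x` such that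
  `Γ(V, 𝓘_{s'}) = u(Γ(V, 𝓘_s)) + ϖ Γ(V, 𝓘_{s'})` for all affine `V ⊆ V_x`, then `u` is an ISOMORPHISM: the union of the affine opens on all of
  whose affine sub-opens `u` is bijective is open and contains the closed fibre, hence is `C` (res-L1-type-o6's
  `Morphisms.eq_top_of_closedFibre_subset`, p573285: a closed set missing the closed fibre of a universally closed `f` is empty), so these
  affine opens form a basis of `C` and `u` is an isomorphism (tree `Modules.isIso_of_bijective_on_basis`).

In B4: `u` is the lift (BRICK E, p574087, on `𝓗om(𝓘_{D₀}, 𝓘_{D₁})`) of the isomorphism `x₀/x₁ : 𝓘_{z₀} ≅ 𝓘_{z₁}` on the closed fibre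
`C_k ≅ ℙ¹`; this file upgrades it to `𝓘_{D₀} ≅ 𝓘_{D₁}`, and (B4-f) `exists_coordinate_functions_of_iso` (p578827) reads off `t₀, t₁`.

References: H. Matsumura, *Commutative Ring Theory* (1986), Thm. 2.2 (Nakayama) [cite: Matsumura1987]; R. Hartshorne, *Algebraic Geometry*
(1977), II Prop. 1.1, II Ex. 5.8 [cite: Hartshorne1977]; U. Görtz, T. Wedhorn, *Algebraic Geometry I* (2020), Rem. 12.57 [cite: GortzWedhorn2020].
-/

set_option linter.dupNamespace false -- mandated namespace `Summit.<Summit>.<Problem>` of this single-conjunct summit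

noncomputable section

open CategoryTheory CategoryTheory.Limits AlgebraicGeometry Opposite TopologicalSpace
open Literature.AlgebraicGeometry.Modules Literature.AlgebraicGeometry.Morphisms
open Literature.AlgebraicGeometry.Deformation Literature.AlgebraicGeometry.Motives Literature.AlgebraicGeometry.HodgeTheory

namespace Summit.ResolutionOfSingularities.ResolutionOfSingularities.Cruxes.EquisingularLiftNat.F102

variable {C : Scheme.{0}}

/-! ## Principal generators of the ideal of a codimension-one regular immersion -/

section Principal

variable {T : Scheme.{0}} (s : T ⟶ C)

/-- **Near every point the ideal of a codimension-one regular immersion is principal**, generated on an affine open by a NONZERO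
function (by `1` off the closed image). `C` integral. [cite: Hartshorne1977, II Prop. 6.13] [OURS · glue] -/
theorem exists_affine_principal [IsIntegral C] (h : IsRegularImmersionOfCodim s 1) (x : C) :
    ∃ V : C.affineOpens, x ∈ (V : C.Opens) ∧ ∃ r : Γ(C, (V : C.Opens)), r ≠ 0 ∧ s.ker.ideal V = Ideal.span {r} := by
  classical
  haveI : IsClosedImmersion s := h.1
  by_cases hx : x ∈ Set.range s.base
  · obtain ⟨z, rfl⟩ := hx
    obtain ⟨V, hzV, rs, hlen, hreg, hI⟩ := h.2 z
    obtain ⟨r, hrs⟩ : ∃ r, rs = [r] := by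
      match rs, hlen with
      | [r], _ => exact ⟨r, rfl⟩
    subst hrs
    haveI : Nonempty (V : C.Opens) := ⟨⟨_, hzV⟩⟩
    have hr : r ≠ 0 := by
      intro hr0
      have h1 := (RingTheory.Sequence.isWeaklyRegular_cons_iff' (M := Γ(C, (V : C.Opens))) r []).mp hreg
      have h2 : IsSMulRegular Γ(C, (V : C.Opens)) r := h1.1
      have h3 : (1 : Γ(C, (V : C.Opens))) = 0 := h2 (by simp [smul_eq_mul, hr0] : r • (1 : Γ(C, (V : C.Opens))) = r • 0)
      exact one_ne_zero h3
    exact ⟨V, hzV, r, hr, by rw [← hI, Ideal.ofList_singleton]⟩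
  · have hopen : IsOpen (Set.range s.base)ᶜ := s.isClosedEmbedding.isClosed_range.isOpen_compl
    obtain ⟨_, ⟨V, hV, rfl⟩, hxV, hVsub⟩ := C.isBasis_affineOpens.exists_subset_of_mem_open (Set.mem_compl hx) hopen
    haveI : Nonempty V := ⟨⟨_, hxV⟩⟩
    have hempty : s ⁻¹ᵁ V = ⊥ := by
      ext z
      simp only [Scheme.Hom.coe_preimage, Set.mem_preimage, SetLike.mem_coe, Opens.coe_bot, Set.mem_empty_iff_false, iff_false]
      exact fun hz => hVsub hz ⟨z, rfl⟩
    refine ⟨⟨V, hV⟩, hxV, 1, one_ne_zero, ?_⟩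
    rw [Ideal.span_singleton_one, eq_top_iff]
    intro a _
    change a ∈ s.ker.ideal ⟨V, hV⟩
    rw [Scheme.Hom.ker_apply, RingHom.mem_ker]
    haveI := subsingleton_sections_preimage_of_eq_bot s V hempty
    exact Subsingleton.elim _ _

/-- Principal generators pass to smaller affine opens (ideal sheaves are quasi-coherent). [folklore] -/
theorem principal_of_le [QuasiCompact s] {V V' : C.affineOpens} (hle : V' ≤ V) (r : Γ(C, (V : C.Opens)))
    (hI : s.ker.ideal V = Ideal.span {r}) :
    s.ker.ideal V' = Ideal.span {C.presheaf.map (homOfLE hle).op r} := by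
  rw [← Scheme.IdealSheafData.map_ideal s.ker hle, hI, Ideal.map_span, Set.image_singleton]

/-- On an integral scheme a nonzero function stays nonzero on a smaller nonempty open. [folklore] -/
theorem map_ne_zero_of_ne_zero [IsIntegral C] {V V' : C.Opens} (hle : V' ≤ V) [Nonempty V'] (r : Γ(C, V)) (hr : r ≠ 0) :
    C.presheaf.map (homOfLE hle).op r ≠ 0 := fun h0 =>
  hr (map_injective_of_isIntegral C (homOfLE hle) (by rw [h0, map_zero]))

/-- The generator as a section of `𝓘_s`: `∃ m ∈ Γ(V, 𝓘_s)` with `ι(m) = r`. [folklore] -/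
theorem exists_section_of_eq_span [QuasiCompact s] (V : C.affineOpens) (r : Γ(C, (V : C.Opens)))
    (hI : s.ker.ideal V = Ideal.span {r}) : ∃ m : Γ(idealModule s, (V : C.Opens)), toRing (idealModuleι s) (V : C.Opens) m = r := by
  have hr : r ∈ RingHom.ker (s.app (V : C.Opens)).hom := by
    rw [← Scheme.Hom.ker_apply, hI]; exact Ideal.mem_span_singleton_self r
  exact exists_kernel_ι_app_eq (structureModuleMap s) (V : C.Opens) r hr

/-- `Γ(V, 𝓘_s) = Γ(V, 𝒪_C) · m` for a generator `m` (`ι(m) = r`, `𝓘_s(V) = (r)`, `r` a non-zero-divisor). [folklore] -/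
theorem exists_eq_smul_of_eq_span [QuasiCompact s] (V : C.affineOpens) (r : Γ(C, (V : C.Opens)))
    (hI : s.ker.ideal V = Ideal.span {r})
    (m : Γ(idealModule s, (V : C.Opens))) (hm : toRing (idealModuleι s) (V : C.Opens) m = r)
    (a : Γ(idealModule s, (V : C.Opens))) : ∃ α : Γ(C, (V : C.Opens)), a = α • m := by
  have ha : toRing (idealModuleι s) (V : C.Opens) a ∈ Ideal.span {r} := by
    rw [← hI, Scheme.Hom.ker_apply]
    exact toRing_mem_ker_app s (V : C.Opens) a
  obtain ⟨α, hα⟩ := Ideal.mem_span_singleton'.mp ha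
  refine ⟨α, toRing_idealModuleι_injective s (V : C.Opens) ?_⟩
  rw [toRing_smul, hm, hα]

end Principal

/-! ## The Nakayama step at a point over the closed point -/

section Nakayama

variable {O : Type} [CommRing O] [IsLocalRing O] (f : C ⟶ Spec (.of O))

/-- A point over the closed point of `O` does not lie in `C_ϖ` for `ϖ ∈ 𝔪_O`. [folklore] -/
theorem not_mem_basicOpen_varpi (ϖ : O) (hϖ : ϖ ∈ IsLocalRing.maximalIdeal O) (x : C)
    (hx : f.base x = IsLocalRing.closedPoint O) : x ∉ C.basicOpen (f.appTop ((Scheme.ΓSpecIso (.of O)).inv ϖ)) := by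
  intro h
  have hpre : C.basicOpen (f.appTop ((Scheme.ΓSpecIso (.of O)).inv ϖ)) =
      f ⁻¹ᵁ (Spec (.of O)).basicOpen ((Scheme.ΓSpecIso (.of O)).inv ϖ) := (Scheme.preimage_basicOpen _ _).symm
  rw [hpre, AlgebraicGeometry.basicOpen_eq_of_affine] at h
  have h' : f.base x ∈ PrimeSpectrum.basicOpen ϖ := h
  rw [hx] at h'
  exact (PrimeSpectrum.mem_basicOpen _ _).mp h' hϖ

variable {T T' : Scheme.{0}} (s : T ⟶ C) (s' : T' ⟶ C) [QuasiCompact s] [QuasiCompact s']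
  (u : idealModule s ⟶ idealModule s')

/-- **The Nakayama step.** `V` affine, `x ∈ V` over the closed point, `m`, `m'` generators of `Γ(V, 𝓘_s)`, `Γ(V, 𝓘_{s'})` reading to
`r`, `r'` with `r'` a non-zero-divisor, `ι(u(m)) = q · r'`; if every `b ∈ Γ(V, 𝓘_{s'})` is `u(a) + ϖ|_V · c`, then `x ∈ C_q`.
[cite: Matsumura1987, Thm. 2.2] [OURS · L1 W4.5b · brick B4 (e)] -/
theorem mem_basicOpen_of_surjective_mod (ϖ : O) (hϖ : ϖ ∈ IsLocalRing.maximalIdeal O) (V : C.affineOpens) (x : C)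
    (hxV : x ∈ (V : C.Opens)) (hx : f.base x = IsLocalRing.closedPoint O)
    (r r' : Γ(C, (V : C.Opens))) (hr' : ∀ a : Γ(C, (V : C.Opens)), a * r' = 0 → a = 0)
    (hI : s.ker.ideal V = Ideal.span {r}) (hI' : s'.ker.ideal V = Ideal.span {r'})
    (m : Γ(idealModule s, (V : C.Opens))) (hm : toRing (idealModuleι s) (V : C.Opens) m = r)
    (m' : Γ(idealModule s', (V : C.Opens))) (hm' : toRing (idealModuleι s') (V : C.Opens) m' = r')
    (q : Γ(C, (V : C.Opens))) (hq : toRing (idealModuleι s') (V : C.Opens) (u.app (V : C.Opens) m) = q * r')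
    (hu : ∀ b : Γ(idealModule s', (V : C.Opens)), ∃ (a : Γ(idealModule s, (V : C.Opens))) (c : Γ(idealModule s', (V : C.Opens))),
      b = u.app (V : C.Opens) a + (f.appTop ((Scheme.ΓSpecIso (.of O)).inv ϖ) |_ (V : C.Opens)) • c) :
    x ∈ C.basicOpen q := by
  set ϖV : Γ(C, (V : C.Opens)) := (f.appTop ((Scheme.ΓSpecIso (.of O)).inv ϖ) |_ (V : C.Opens)) with hϖV
  -- `m' = u(α m) + ϖ γ m'`, read in `𝒪_C`: `r' = α q r' + ϖ γ r'`, so `1 = α q + ϖ γ`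
  obtain ⟨a, c, hac⟩ := hu m'
  obtain ⟨α, rfl⟩ := exists_eq_smul_of_eq_span s V r hI m hm a
  obtain ⟨γ, rfl⟩ := exists_eq_smul_of_eq_span s' V r' hI' m' hm' c
  have h1 : (1 - (α * q + ϖV * γ)) * r' = 0 := by
    have h := congrArg (toRing (idealModuleι s') (V : C.Opens)) hac
    rw [toRing_add, Scheme.Modules.Hom.app_smul, toRing_smul, toRing_smul, toRing_smul, hq, hm'] at h
    linear_combination h
  have h2 : α * q + ϖV * γ = 1 := by
    have := hr' _ h1
    exact (sub_eq_zero.mp this).symm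
  -- at `x`: `ϖ_x ∈ 𝔪_x`, so `α_x q_x = 1 - ϖ_x γ_x` is a unit, hence `q_x` is
  have hϖx : ¬ IsUnit (C.presheaf.germ (V : C.Opens) x hxV ϖV) := by
    intro hunit
    apply not_mem_basicOpen_varpi f ϖ hϖ x hx
    have hxb : x ∈ C.basicOpen ϖV := (Scheme.mem_basicOpen _ _ x hxV).mpr hunit
    exact (Scheme.basicOpen_restrict C _ _) hxb
  have h3 : IsUnit (C.presheaf.germ (V : C.Opens) x hxV (α * q)) := by
    have h4 : C.presheaf.germ (V : C.Opens) x hxV (α * q) = 1 - C.presheaf.germ (V : C.Opens) x hxV (ϖV * γ) := by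
      rw [eq_sub_iff_add_eq, ← map_add, h2, map_one]
    rw [h4]
    apply IsLocalRing.isUnit_one_sub_self_of_mem_nonunits
    rw [map_mul]
    exact mul_mem_nonunits_left ((mem_nonunits_iff).mpr hϖx)
  rw [map_mul] at h3
  exact (Scheme.mem_basicOpen _ _ x hxV).mpr (isUnit_of_mul_isUnit_right h3)

end Nakayama

/-! ## Bijectivity on an affine open where the ratio is a unit -/

section Bijective

variable {T T' : Scheme.{0}} (s : T ⟶ C) (s' : T' ⟶ C) [QuasiCompact s] [QuasiCompact s']
  (u : idealModule s ⟶ idealModule s')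

/-- **`u_V` is bijective on an affine open with generators `m`, `m'` (`ι(m') = r'` a non-zero-divisor, `r ≠ 0` in a domain) and
`ι(u(m)) = q r'` with `q` a unit.** [OURS · L1 W4.5b · brick B4 (e)] -/
theorem bijective_app_of_isUnit (V : C.affineOpens) [IsDomain Γ(C, (V : C.Opens))] (r r' : Γ(C, (V : C.Opens)))
    (hr'0 : r' ≠ 0) (hI : s.ker.ideal V = Ideal.span {r}) (hI' : s'.ker.ideal V = Ideal.span {r'})
    (m : Γ(idealModule s, (V : C.Opens))) (hm : toRing (idealModuleι s) (V : C.Opens) m = r)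
    (m' : Γ(idealModule s', (V : C.Opens))) (hm' : toRing (idealModuleι s') (V : C.Opens) m' = r')
    (q : Γ(C, (V : C.Opens))) (hq : toRing (idealModuleι s') (V : C.Opens) (u.app (V : C.Opens) m) = q * r') (hqu : IsUnit q) :
    Function.Bijective (u.app (V : C.Opens)) := by
  have hr' : ∀ a : Γ(C, (V : C.Opens)), a * r' = 0 → a = 0 := fun a ha => (mul_eq_zero.mp ha).resolve_right hr'0
  have hum : u.app (V : C.Opens) m = q • m' := by
    apply toRing_idealModuleι_injective s' (V : C.Opens)
    rw [hq, toRing_smul, hm']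
  constructor
  · intro a b hab
    obtain ⟨α, rfl⟩ := exists_eq_smul_of_eq_span s V r hI m hm a
    obtain ⟨β, rfl⟩ := exists_eq_smul_of_eq_span s V r hI m hm b
    rw [Scheme.Modules.Hom.app_smul, Scheme.Modules.Hom.app_smul, hum, smul_smul, smul_smul] at hab
    have h := congrArg (toRing (idealModuleι s') (V : C.Opens)) hab
    rw [toRing_smul, toRing_smul, hm'] at h
    have h' : (α - β) * q * r' = 0 := by linear_combination h
    have h'' : (α - β) * q = 0 := hr' _ h'
    have hαβ : α - β = 0 := (mul_eq_zero.mp h'').resolve_right hqu.ne_zero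
    rw [sub_eq_zero.mp hαβ]
  · intro b
    obtain ⟨β, rfl⟩ := exists_eq_smul_of_eq_span s' V r' hI' m' hm' b
    obtain ⟨qi, hqi⟩ := hqu.exists_left_inv
    refine ⟨(β * qi) • m, ?_⟩
    rw [Scheme.Modules.Hom.app_smul, hum, smul_smul, mul_assoc, hqi, mul_one]

end Bijective

/-! ## (B4-e) The global statement -/

section Global

variable {O : Type} [CommRing O] [IsLocalRing O] (f : C ⟶ Spec (.of O)) [UniversallyClosed f]
  {T T' : Scheme.{0}} (s : T ⟶ C) (s' : T' ⟶ C) (u : idealModule s ⟶ idealModule s')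

/-- **(B4-e) A morphism of the section ideals which is onto modulo `ϖ` near the closed fibre is an isomorphism.** `f : C → Spec O`
universally closed over a local ring, `C` integral, `s`, `s'` regular immersions of codimension one, `u : 𝓘_s → 𝓘_{s'}`, `ϖ ∈ 𝔪_O`; if every
point over the closed point has a neighbourhood `V_x` with `Γ(V, 𝓘_{s'}) = u(Γ(V, 𝓘_s)) + ϖ Γ(V, 𝓘_{s'})` for all affine `V ⊆ V_x`, then `u` is an
isomorphism. [cite: Matsumura1987, Thm. 2.2] [cite: Hartshorne1977, II Prop. 1.1] [OURS · L1 W4.5b · brick B4 (e)] toward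
`F102.exists_coordinate_functions`; NOT a statement of the manuscript. -/
theorem isIso_of_surjective_mod [IsIntegral C] (hs : IsRegularImmersionOfCodim s 1) (hs' : IsRegularImmersionOfCodim s' 1)
    (ϖ : O) (hϖ : ϖ ∈ IsLocalRing.maximalIdeal O)
    (hu : ∀ x : C, f.base x = IsLocalRing.closedPoint O → ∃ Vx : C.Opens, x ∈ Vx ∧ ∀ V : C.affineOpens, (V : C.Opens) ≤ Vx →
      ∀ b : Γ(idealModule s', (V : C.Opens)), ∃ (a : Γ(idealModule s, (V : C.Opens))) (c : Γ(idealModule s', (V : C.Opens))),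
        b = u.app (V : C.Opens) a + (f.appTop ((Scheme.ΓSpecIso (.of O)).inv ϖ) |_ (V : C.Opens)) • c) :
    IsIso u := by
  classical
  haveI : IsClosedImmersion s := hs.1
  haveI : IsClosedImmersion s' := hs'.1
  -- the good affine opens: `u` bijective on every affine sub-open
  set S : Set C.affineOpens := {W | ∀ V : C.affineOpens, V ≤ W → Function.Bijective (u.app (V : C.Opens))} with hS
  set U : C.Opens := ⨆ W : S, ((W : C.affineOpens) : C.Opens) with hU
  -- every point over the closed point lies in a good affine open
  have hfib : ∀ x : C, f.base x = IsLocalRing.closedPoint O → x ∈ U := by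
    intro x hx
    obtain ⟨Vx, hxVx, hVx⟩ := hu x hx
    obtain ⟨V₀, hxV₀, r₀, -, hI₀⟩ := exists_affine_principal s hs x
    obtain ⟨V₁, hxV₁, r₁, hr₁, hI₁⟩ := exists_affine_principal s' hs' x
    -- a common affine neighbourhood `V ⊆ Vx ∩ V₀ ∩ V₁`
    obtain ⟨_, ⟨V, hV, rfl⟩, hxV, hVsub⟩ := C.isBasis_affineOpens.exists_subset_of_mem_open
      (show x ∈ ((Vx ⊓ (V₀ : C.Opens) ⊓ (V₁ : C.Opens) : C.Opens) : Set C) from ⟨⟨hxVx, hxV₀⟩, hxV₁⟩)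
      (Vx ⊓ (V₀ : C.Opens) ⊓ (V₁ : C.Opens)).isOpen
    have hVVx : V ≤ Vx := fun y hy => (hVsub hy).1.1
    have hVV₀ : (⟨V, hV⟩ : C.affineOpens) ≤ V₀ := fun y hy => (hVsub hy).1.2
    have hVV₁ : (⟨V, hV⟩ : C.affineOpens) ≤ V₁ := fun y hy => (hVsub hy).2
    haveI : Nonempty V := ⟨⟨x, hxV⟩⟩
    -- generators on `V`
    set rV : Γ(C, V) := C.presheaf.map (homOfLE hVV₀).op r₀ with hrV
    set rV' : Γ(C, V) := C.presheaf.map (homOfLE hVV₁).op r₁ with hrV'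
    have hrV'0 : rV' ≠ 0 := map_ne_zero_of_ne_zero hVV₁ r₁ hr₁
    have hIV : s.ker.ideal ⟨V, hV⟩ = Ideal.span {rV} := principal_of_le s hVV₀ r₀ hI₀
    have hIV' : s'.ker.ideal ⟨V, hV⟩ = Ideal.span {rV'} := principal_of_le s' hVV₁ r₁ hI₁
    obtain ⟨m, hm⟩ := exists_section_of_eq_span s ⟨V, hV⟩ rV hIV
    obtain ⟨m', hm'⟩ := exists_section_of_eq_span s' ⟨V, hV⟩ rV' hIV'
    -- the ratio `q`: `ι(u(m)) ∈ 𝓘_{s'}(V) = (rV')`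
    have hqmem : toRing (idealModuleι s') V (u.app V m) ∈ Ideal.span {rV'} := by
      rw [← hIV', Scheme.Hom.ker_apply]
      exact toRing_mem_ker_app s' V _
    obtain ⟨q, hq⟩ := Ideal.mem_span_singleton'.mp hqmem
    have hr' : ∀ a : Γ(C, V), a * rV' = 0 → a = 0 := fun a ha => (mul_eq_zero.mp ha).resolve_right hrV'0
    have hxq : x ∈ C.basicOpen q :=
      mem_basicOpen_of_surjective_mod f s s' u ϖ hϖ ⟨V, hV⟩ x hxV hx rV rV' hr' hIV hIV' m hm m' hm' q hq.symm
        (hVx ⟨V, hV⟩ hVVx)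
    -- the good affine open `C_q ⊆ V`
    have hDaff : IsAffineOpen (C.basicOpen q) := hV.basicOpen q
    have hD : (⟨C.basicOpen q, hDaff⟩ : C.affineOpens) ∈ S := by
      intro V' hV'
      have hV'D : (V' : C.Opens) ≤ C.basicOpen q := hV'
      have hV'V : (V' : C.Opens) ≤ V := fun y hy => C.basicOpen_le q (hV'D hy)
      by_cases hne : Nonempty (V' : C.Opens)
      · -- transport the generators to `V'`
        have hIW : s.ker.ideal V' = Ideal.span {C.presheaf.map (homOfLE hV'V).op rV} :=
          principal_of_le s (V := ⟨V, hV⟩) hV'V rV hIV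
        have hIW' : s'.ker.ideal V' = Ideal.span {C.presheaf.map (homOfLE hV'V).op rV'} :=
          principal_of_le s' (V := ⟨V, hV⟩) hV'V rV' hIV'
        refine bijective_app_of_isUnit s s' u V' _ _ (map_ne_zero_of_ne_zero hV'V rV' hrV'0)
          hIW hIW' ((idealModule s).presheaf.map (homOfLE hV'V).op m) (by rw [← map_toRing, hm])
          ((idealModule s').presheaf.map (homOfLE hV'V).op m') (by rw [← map_toRing, hm'])
          (C.presheaf.map (homOfLE hV'V).op q) ?_ ?_
        · rw [← map_app_section, ← map_toRing, ← hq, map_mul]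
        · have h1 : IsUnit (C.presheaf.map (homOfLE (C.basicOpen_le q)).op q) :=
            C.toLocallyRingedSpace.toRingedSpace.isUnit_res_basicOpen q
          have h2 : C.presheaf.map (homOfLE hV'V).op q =
              C.presheaf.map (homOfLE hV'D).op (C.presheaf.map (homOfLE (C.basicOpen_le q)).op q) := by
            rw [← CommRingCat.comp_apply, ← Functor.map_comp]; rfl
          rw [h2]
          exact h1.map _
      · -- empty `V'`: all section groups vanish
        have hbot : (V' : C.Opens) = ⊥ := by
          ext y
          simp only [Opens.coe_bot, Set.mem_empty_iff_false, iff_false]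
          exact fun hy => hne ⟨⟨y, hy⟩⟩
        have hsub : ∀ M : C.Modules, ∀ a : Γ(M, (V' : C.Opens)), a = 0 := fun M a => by
          have hT : Limits.IsTerminal (M.presheaf.obj (op (V' : C.Opens))) := by
            rw [hbot]
            exact TopCat.Sheaf.isTerminalOfEmpty (⟨M.presheaf, M.isSheaf⟩ : TopCat.Sheaf Ab C)
          have h := hT.hom_ext (𝟙 _) 0
          exact congrArg (fun φ : M.presheaf.obj (op (V' : C.Opens)) ⟶ _ => φ a) h
        exact ⟨fun a b _ => by rw [hsub _ a, hsub _ b], fun b => ⟨0, by rw [hsub _ b, map_zero]⟩⟩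
    exact Opens.mem_iSup.mpr ⟨⟨_, hD⟩, hxq⟩
  -- hence `U = C`, and the affine sub-opens of good affine opens form a basis
  have hUtop : U = ⊤ := eq_top_of_closedFibre_subset f U hfib
  set B : Set C.Opens := {V | ∃ hV : IsAffineOpen V, ∃ W ∈ S, (⟨V, hV⟩ : C.affineOpens) ≤ W} with hB
  have hBasis : Opens.IsBasis B := by
    rw [Opens.isBasis_iff_nbhd]
    intro W x hxW
    have hxU : x ∈ U := by rw [hUtop]; trivial
    obtain ⟨W₀, hxW₀⟩ := Opens.mem_iSup.mp hxU
    obtain ⟨_, ⟨V, hV, rfl⟩, hxV, hVsub⟩ := C.isBasis_affineOpens.exists_subset_of_mem_open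
      (show x ∈ ((W ⊓ ((W₀ : C.affineOpens) : C.Opens) : C.Opens) : Set C) from ⟨hxW, hxW₀⟩) (W ⊓ ((W₀ : C.affineOpens) : C.Opens)).isOpen
    exact ⟨V, ⟨hV, W₀, W₀.2, fun y hy => (hVsub hy).2⟩, hxV, fun y hy => (hVsub hy).1⟩
  exact isIso_of_bijective_on_basis u hBasis fun V ⟨hV, W, hW, hle⟩ => hW ⟨V, hV⟩ hle

end Global

end Summit.ResolutionOfSingularities.ResolutionOfSingularities.Cruxes.EquisingularLiftNat.F102

end
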